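import Summits.CriticalPhenomena.SAWScalingLimit.Theorems.SAWLeftRightFKGSAWTraversalBound
import Literature.Probability.RandomPlanarGeometry.CurveTightness
import Literature.Probability.LatticeModels.CellDomainBoundary

/-!
# `SAWLeftRightFKG.TraversalBoundTight` (stmt-CriticalPhenomena-1882): the Aizenman–Burchard
criterion applied to the critical SAW, and `SAWTraversalBound ↔ EventualTight`

Proves the route's glue item `TraversalBoundTight : SAWTraversalBound → EventualTight`
(`TraversalBoundTight_proof`) by the tree's PROVED tightness criterion
`isTightMeasureSet_of_traversalBounds` (Aizenman–Burchard, Duke Math. J. 99 (1999), Thms 1.1–1.2)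
in `E = ℂ`, `Λ` a closed disc containing `D` and the heads `δ · a δ` for small `δ`, covering exponent
`d = 2` (`exists_finset_card_le_cover_closedBall`), random curves = the mesh polylines of the SAW
(whose classes are `DomainSAW.curve`), index set `T = (0, δ₂]`, followed by the bridge
`isTightAlongMesh_of_isTightMeasureSet_image`. The two deterministic inputs are proved here:

* `not_hasTraversals_toCurve_of_radius_le` — **(H0) short-distance cutoff**: at mesh `δ` no
  self-avoiding walk of `Ω_δ` traverses a shell of inner radius `ρ ≤ δ` by `75` separate segments
  (an edge whose rescaled segment meets `B̄(x, ρ)` starts within `2δ` of `x`; distinct start vertices;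
  `≤ 36` sites in that window; `≤ 37` order-connected pieces of time, two traversals each —
  `segMeetCount_map_le_card_of_chain`, `Percolation.hasOrdConnectedCover_preimage_polylineFrom`,
  `Percolation.le_of_hasTraversals_of_hasOrdConnectedCover`);
* `range_toCurve_subset_of_convex` — the polyline stays in any convex set containing its vertices.

With `sawTraversalBound_of_eventualTight` (`SAWLeftRightFKGSAWTraversalBound.lean`) this gives
`sawTraversalBound_iff_eventualTight`: items stmt-1880 and stmt-1881 are equivalent — (H1) as typed is
exactly the (open) precompactness of the critical planar SAW. No named fact is used.
-/

noncomputable section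

open MeasureTheory Filter Topology Set Metric
open Literature.Probability.RandomPlanarGeometry Literature.Probability.LatticeModels
open Literature.Probability.Percolation
open Summit.CriticalPhenomena.SAWScalingLimit.Theses.SAWLeftRightFKG
open scoped ENNReal unitInterval

namespace Summit.CriticalPhenomena.SAWScalingLimit.Theorems

/-- **Counting the segments meeting a set through their START vertices.** If consecutive points of
`a :: l` are related by `r`, the list has no repetition, and every point `p` of the list followed by
an `r`-successor `q` whose image segment `[φ p, φ q]` meets `C` belongs to the finite set `Q`, then at
most `#Q` segments of the image polyline meet `C`. [folklore] -/
theorem segMeetCount_map_le_card_of_chain {α V : Type*} [NormedAddCommGroup V] [NormedSpace ℝ V]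
    [DecidableEq α] (C : Set V) (φ : α → V) (r : α → α → Prop) (a : α) (l : List α)
    (hchain : List.IsChain r (a :: l)) (hnd : (a :: l).Nodup) (Q : Finset α)
    (hQ : ∀ p ∈ a :: l, ∀ q, r p q → (segment ℝ (φ p) (φ q) ∩ C).Nonempty → p ∈ Q) :
    segMeetCount C (φ a) (l.map φ) ≤ Q.card := by
  classical
  induction l generalizing a Q with
  | nil => exact Nat.zero_le _
  | cons b l ih =>
    rw [List.isChain_cons_cons] at hchain
    obtain ⟨hab, hbl⟩ := hchain
    rw [List.nodup_cons] at hnd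
    obtain ⟨ha, hnd'⟩ := hnd
    change (if (segment ℝ (φ a) (φ b) ∩ C).Nonempty then 1 else 0) + segMeetCount C (φ b) (l.map φ)
      ≤ Q.card
    split_ifs with hmeet
    · have haQ : a ∈ Q := hQ a (by simp) b hab hmeet
      have hih := ih b hbl hnd' (Q.erase a) fun p hp q hpq hm =>
        Finset.mem_erase.2 ⟨fun h => ha (h ▸ hp), hQ p (List.mem_cons_of_mem _ hp) q hpq hm⟩
      rw [Finset.card_erase_of_mem haQ] at hih
      have := Finset.card_pos.2 ⟨_, haQ⟩
      omega
    · simpa using ih b hbl hnd' Q fun p hp q hpq hm => hQ p (List.mem_cons_of_mem _ hp) q hpq hm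

/-- Integer window: if `|δ m - t| ≤ 2δ` with `δ > 0` then `m ∈ [⌊t/δ⌋ - 2, ⌊t/δ⌋ + 3]`. [folklore] -/
theorem mem_Icc_floor_of_abs_le {δ t : ℝ} (hδ : 0 < δ) {m : ℤ} (hm : |δ * (m : ℝ) - t| ≤ 2 * δ) :
    m ∈ Finset.Icc (⌊t / δ⌋ - 2) (⌊t / δ⌋ + 3) := by
  obtain ⟨hlo, hhi⟩ := abs_le.1 hm
  have h1 : (m : ℝ) - 2 ≤ t / δ := by rw [le_div_iff₀ hδ]; nlinarith
  have h2 : t / δ ≤ (m : ℝ) + 2 := by rw [div_le_iff₀ hδ]; nlinarith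
  have hfl1 : (⌊t / δ⌋ : ℝ) ≤ t / δ := Int.floor_le _
  have hfl2 : t / δ < (⌊t / δ⌋ : ℝ) + 1 := Int.lt_floor_add_one _
  refine Finset.mem_Icc.2 ⟨?_, ?_⟩
  · have : (⌊t / δ⌋ : ℝ) - 2 ≤ m := by linarith
    exact_mod_cast this
  · have : (m : ℝ) < ⌊t / δ⌋ + 3 := by linarith
    have : m < ⌊t / δ⌋ + 3 := by exact_mod_cast this
    omega

/-- **(H0) Short-distance cutoff for SAW polylines.** At mesh `δ > 0`, the polyline of a
self-avoiding walk of the discrete domain `Ω_δ` never traverses a shell `D(x; ρ, R)` of inner radius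
`ρ ≤ δ` (`ρ < R`) by `75` separate segments: a lattice edge whose rescaled segment meets `B̄(x, ρ)`
starts within `2δ` of `x`, the walk uses pairwise distinct start vertices, at most `36` sites of `ℤ²`
have their mesh point in that window, so the times spent in `B̄(x, ρ)` are covered by `≤ 37`
intervals, each carrying at most two separate traversals. (Aizenman–Burchard 1999, §1.a,
"short-distance cutoff".) [folklore] -/
theorem not_hasTraversals_toCurve_of_radius_le {Ω : Set ℂ} {δ : ℝ} (hδ : 0 < δ) {u v : Site 2}
    (w : (discreteDomainGraph Ω δ).Walk u v) (hw : w.IsPath) {x : ℂ} {ρ R : ℝ}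
    (hρδ : ρ ≤ δ) (hρR : ρ < R) :
    ¬ (⟨w.toCurve (meshPoint δ)⟩ : Curve ℂ).HasTraversals 75 x ρ R := by
  classical
  intro hk
  obtain ⟨l, hl⟩ : ∃ l, w.support = u :: l := ⟨_, w.cons_tail_support.symm⟩
  have hcurve : (⟨w.toCurve (meshPoint δ)⟩ : Curve ℂ) =
      ⟨(polylineFrom (meshPoint δ u) (l.map (meshPoint δ))).2.toContinuousMap⟩ := by
    rw [SimpleGraph.Walk.toCurve, hl]
    rfl
  rw [hcurve] at hk
  have hcov := hasOrdConnectedCover_preimage_polylineFrom (convex_closedBall x ρ) (meshPoint δ u)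
    (l.map (meshPoint δ))
  have hle := le_of_hasTraversals_of_hasOrdConnectedCover
    (γ := (⟨(polylineFrom (meshPoint δ u) (l.map (meshPoint δ))).2.toContinuousMap⟩ : Curve ℂ))
    hρR hcov hk
  -- the window of start vertices
  set c : Fin 2 → ℤ := ![⌊x.re / δ⌋, ⌊x.im / δ⌋] with hc
  set Q : Finset (Site 2) := Fintype.piFinset fun i : Fin 2 => Finset.Icc (c i - 2) (c i + 3) with hQ
  have hQcard : Q.card = 36 := by
    have h6 : ∀ m : ℤ, (Finset.Icc (m - 2) (m + 3)).card = 6 := fun m => by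
      rw [Int.card_Icc]; omega
    have h36 : (6 : ℕ) * 6 = 36 := by norm_num
    rw [hQ, Fintype.card_piFinset, Fin.prod_univ_two, h6, h6, h36]
  have hchain : List.IsChain (discreteDomainGraph Ω δ).Adj (u :: l) := by
    have := w.isChain_adj_support
    rwa [hl] at this
  have hnd : (u :: l).Nodup := hl ▸ hw.support_nodup
  have hseg := segMeetCount_map_le_card_of_chain (closedBall x ρ) (meshPoint δ)
    (discreteDomainGraph Ω δ).Adj u l hchain hnd Q ?_
  · omega
  -- membership in the window
  intro p _ q hpq hmeet
  obtain ⟨z, hzseg, hzball⟩ := hmeet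
  have hadj : (zdGraph 2).Adj p q :=
    meshGraph_le_zdGraph _ _ (discreteDomainGraph_le_meshGraph _ _ hpq)
  have hPQ : meshPoint δ q ∈ closedBall (meshPoint δ p) δ := by
    rw [mem_closedBall, dist_eq_norm]
    obtain ⟨-, -, h3⟩ := abs_re_im_meshPoint_sub_of_adj hδ.le hadj
    exact (Complex.norm_le_abs_re_add_abs_im _).trans h3.le
  have hz : z ∈ closedBall (meshPoint δ p) δ :=
    (convex_closedBall _ _).segment_subset (mem_closedBall_self hδ.le) hPQ hzseg
  have hdist : ‖meshPoint δ p - x‖ ≤ 2 * δ := by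
    rw [mem_closedBall, dist_comm, dist_eq_norm] at hz
    rw [mem_closedBall, dist_eq_norm] at hzball
    have := norm_sub_le_norm_sub_add_norm_sub (meshPoint δ p) z x
    linarith
  rw [hQ, Fintype.mem_piFinset]
  intro i
  fin_cases i
  · have h := (Complex.abs_re_le_norm (meshPoint δ p - x)).trans hdist
    rw [Complex.sub_re, meshPoint_re] at h
    simpa [hc] using mem_Icc_floor_of_abs_le hδ h
  · have h := (Complex.abs_im_le_norm (meshPoint δ p - x)).trans hdist
    rw [Complex.sub_im, meshPoint_im] at h
    simpa [hc] using mem_Icc_floor_of_abs_le hδ h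

/-- The polyline of a walk stays in any convex set containing the embedded vertices of its support.
[folklore] -/
theorem range_toCurve_subset_of_convex {V : Type*} {G : SimpleGraph V} {u v : V} {emb : V → ℂ} (w : G.Walk u v)
    {C : Set ℂ} (hC : Convex ℝ C) (h : ∀ p ∈ w.support, emb p ∈ C) :
    Set.range (w.toCurve emb) ⊆ C := by
  obtain ⟨l, hl⟩ : ∃ l, w.support = u :: l := ⟨_, w.cons_tail_support.symm⟩
  have hcurve : w.toCurve emb = (polylineFrom (emb u) (l.map emb)).2.toContinuousMap := by
    rw [SimpleGraph.Walk.toCurve, hl]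
    rfl
  rw [hcurve]
  have hu : emb u ∈ C := h u (by simp)
  have hl' : ∀ p ∈ l.map emb, p ∈ C := by
    intro p hp
    obtain ⟨q, hq, rfl⟩ := List.mem_map.1 hp
    exact h q (by rw [hl]; exact List.mem_cons_of_mem _ hq)
  exact range_polylineFrom_subset hC hu hl'

/-- **Proof of the glue item `TraversalBoundTight` (stmt-CriticalPhenomena-1882)**:
`SAWTraversalBound → EventualTight`, by the tree's Aizenman–Burchard criterion
`isTightMeasureSet_of_traversalBounds` in `E = ℂ`, `Λ = B̄(0, r₀)` (`r₀ = max r 0 + 1` for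
`D ⊆ B̄(0, r)`, so that `Λ` contains `Ω_δ` and, for small `δ`, the head `δ · a δ → a ∈ ∂D`),
covering exponent `d = 2` (`exists_finset_card_le_cover_closedBall`), random curves
`X_δ γ = ` the mesh polyline (whose class is `γ.curve`), threshold `max 75 (k x ρ R)` ((H0) from
`not_hasTraversals_toCurve_of_radius_le`, (H1) from the hypothesis), index set `T = (0, δ₂]`,
`δ₂ = min (min δ₀ 1) (δ₁/2)`; then `isTightAlongMesh_of_isTightMeasureSet_image` with the automatic
a.e.-measurability `SAW.aemeasurable_curve`. (Aizenman–Burchard 1999, Thm 1.2.) [folklore] -/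
theorem TraversalBoundTight_proof : TraversalBoundTight := by
  classical
  intro h1 D a b hab
  obtain ⟨k, K, lam, δ₀, hK, hlam, hδ₀, hbd⟩ := h1 D a b hab
  obtain ⟨r, hr⟩ := (Metric.isBounded_iff_subset_closedBall (0 : ℂ)).1 D.isBounded
  set r₀ : ℝ := max r 0 + 1 with hr₀def
  have hr₀ : 0 ≤ r₀ := by rw [hr₀def]; positivity
  have hrr : closedBall (0 : ℂ) r ⊆ closedBall 0 (max r 0) :=
    closedBall_subset_closedBall (le_max_left _ _)
  have hmax : closedBall (0 : ℂ) (max r 0) ⊆ closedBall 0 r₀ :=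
    closedBall_subset_closedBall (by rw [hr₀def]; linarith)
  have hDr₀ : D.carrier ⊆ closedBall 0 r₀ := hr.trans (hrr.trans hmax)
  -- the marked point `a` lies in `B̄(0, max r 0)`
  have hpt : D.pt 0 ∈ closedBall (0 : ℂ) (max r 0) := by
    have h1 : D.pt 0 ∈ frontier D.carrier := D.toJordanDomain.boundary_mem_frontier (D.mark 0)
    exact (frontier_subset_closure.trans
      (closure_minimal (hr.trans hrr) isClosed_closedBall)) h1
  -- eventually the head of the walk is in `Λ`
  have hev_head : ∀ᶠ δ in 𝓝[>] (0 : ℝ), meshPoint δ (a δ) ∈ closedBall (0 : ℂ) r₀ := by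
    filter_upwards [hab.tendsto_fst (Metric.ball_mem_nhds (D.pt 0) one_pos)] with δ hδ
    rw [mem_closedBall]
    have hδ' := (mem_ball.1 hδ).le
    have hpt' := mem_closedBall.1 hpt
    calc dist (meshPoint δ (a δ)) 0
        ≤ dist (meshPoint δ (a δ)) (D.pt 0) + dist (D.pt 0) 0 := dist_triangle _ _ _
      _ ≤ 1 + max r 0 := add_le_add hδ' hpt'
      _ = r₀ := by rw [hr₀def]; ring
  obtain ⟨δ₁, hδ₁, hsub₁⟩ := mem_nhdsGT_iff_exists_Ioo_subset.1 hev_head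
  have hδ₁pos : 0 < δ₁ := hδ₁
  set δ₂ : ℝ := min (min δ₀ 1) (δ₁ / 2) with hδ₂def
  have hδ₂ : 0 < δ₂ := lt_min (lt_min hδ₀ one_pos) (by positivity)
  have hT1 : Set.Ioc 0 δ₂ ⊆ Set.Ioc (0 : ℝ) 1 :=
    Set.Ioc_subset_Ioc_right ((min_le_left _ _).trans (min_le_right _ _))
  have hT0 : Set.Ioc 0 δ₂ ⊆ Set.Ioc (0 : ℝ) δ₀ :=
    Set.Ioc_subset_Ioc_right ((min_le_left _ _).trans (min_le_left _ _))
  have hTδ₁ : ∀ δ ∈ Set.Ioc (0 : ℝ) δ₂, δ ∈ Set.Ioo (0 : ℝ) δ₁ := fun δ hδ =>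
    ⟨hδ.1, (hδ.2.trans (min_le_right _ _)).trans_lt (by linarith)⟩
  have key := isTightMeasureSet_of_traversalBounds (E := ℂ) (isCompact_closedBall (0 : ℂ) r₀)
    (C := 9 * (r₀ + 2) ^ 2) (d := 2) zero_le_two
    (fun ρ hρ hρ1 => exists_finset_card_le_cover_closedBall hr₀ ρ hρ hρ1)
    (Ω := fun δ => SAW.DomainSAW D.carrier δ (a δ) (b δ))
    (fun δ => SAW.law D.carrier δ (a δ) (b δ))
    (fun δ γ => (⟨γ.walk.toCurve (meshPoint δ)⟩ : Curve ℂ))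
    (fun x ρ R => max 75 (k x ρ R)) hK hlam hT1 ?_ ?_
  · have hY : ∀ᶠ δ in 𝓝[>] (0 : ℝ),
        AEMeasurable (fun γ : SAW.DomainSAW D.carrier δ (a δ) (b δ) => γ.curve)
          (SAW.law D.carrier δ (a δ) (b δ)) :=
      Eventually.of_forall fun δ => SAW.aemeasurable_curve _ _ _ _
    exact isTightAlongMesh_of_isTightMeasureSet_image hY hδ₂ key
  · -- (H0)
    intro δ hδ
    refine ae_of_all _ fun γ => ⟨?_, fun x ρ R _ hρδ hρR htr => ?_⟩
    · change Set.range (γ.walk.toCurve (meshPoint δ)) ⊆ closedBall 0 r₀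
      refine range_toCurve_subset_of_convex γ.walk (convex_closedBall 0 r₀) fun p hp => ?_
      rcases γ.walk.mem_support_iff.1 hp with rfl | htl
      · exact hsub₁ (hTδ₁ δ hδ)
      · exact hDr₀ (meshDomain_subset_meshVertices _ _
          (mem_meshDomain_of_mem_support_tail γ.walk htl))
    · exact not_hasTraversals_toCurve_of_radius_le hδ.1 γ.walk γ.isPath hρδ hρR
        (htr.of_le (le_max_left _ _))
  · -- (H1)
    intro δ hδ x ρ R hδρ hρR hR1
    refine le_trans (measure_mono fun γ hγ => ?_) (hbd δ (hT0 hδ) x ρ R hδρ hρR hR1)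
    exact hγ.of_le (le_max_right _ _)

/-- **`SAWTraversalBound ↔ EventualTight`** (items stmt-CriticalPhenomena-1880 and 1881 are
equivalent, unconditionally): the Aizenman–Burchard hypothesis (H1) for the critical SAW, as typed
with a shell-dependent threshold, is EXACTLY eventual tightness of its laws — forward by the AB
criterion (`TraversalBoundTight_proof`), backward by compactness and the lattice short-distance count
(`sawTraversalBound_of_eventualTight`). [folklore] -/
theorem sawTraversalBound_iff_eventualTight : SAWTraversalBound ↔ EventualTight :=
  ⟨TraversalBoundTight_proof, sawTraversalBound_of_eventualTight⟩

end Summit.CriticalPhenomena.SAWScalingLimit.Theorems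

end
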